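import Literature.Barriers.ABC.BakerMethodBounds
import Literature.Barriers.ABC.BakerMethodBoundsStewartYuProofs
import Literature.NumberTheory.DiophantineGeometry.PastenSubexpGenerators
import HarnessLib

/-!
# Pasten's Theorem 1.4 (1) deduced from his Theorems 2.1 and 2.5 (proofs)

Sibling proof file of `BakerMethodBounds.lean` (D-0014); no new definitions.

H. Pasten, *The largest prime factor of `n² + 1` and improvements on subexponential `ABC`*,
Invent. Math. 236 (2024), 373–385, Theorem 1.4 (1) [cite: Pasten2024, Theorem 1.4 (1)]:
"There is an absolute constant `κ > 0` such that if `a ≤ c^{1−η}` for a number `η > 0`, then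
`log c ≤ η⁻¹ exp(κ · √((log R) log₂ R))`" (`a + b = c` coprime positive, `R = rad(abc)`), the
named fact `Literature.Barriers.ABC.pasten2024_thm_1_4_1`. Its printed proof (§4) rests
on three deep inputs, each a named fact of `Literature/`:

* Theorem 2.1 (i) = Evertse–Győry, *Unit Equations in Diophantine Number Theory*, Thm 4.2.1,
  for `K = ℚ` (lower bounds for linear forms in logarithms):
  `Literature.NumberTheory.DiophantineGeometry.Dioph.evertseGyory_thm_4_2_1_rat`, from which
  `MultiplicativeGroupApproximation.lean` PROVES Pasten's form
  `PastenApproximationBound pastenK` (`Dioph.pasten2024_thm_2_1`);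
* Theorem 2.5 = Pasten, J. Number Theory 254 (2024), Thm 16.8 (Shimura curves):
  `Literature.NumberTheory.DiophantineGeometry.pasten2024_thm_2_5`;
* "any exponential bound for the `ABC` conjecture (such as the one in [ABC1] which gives
  `K' = 15`)": Stewart–Tijdeman 1986, `stewartTijdeman1986_upperBound` (`log c ≤ κ R^{15}`), a
  record of the barrier catalogue. This third printed input is NOT an independent hypothesis of
  the deduction: in the tree it follows from the first one — Theorem 2.1 in Pasten's form already
  gives Stewart–Yu's `log c ≤ κ R^{1/3} (log R)³`
  (`bakerShapeBound_third_three_of_approximationBound`, file `BakerMethodBoundsStewartYuProofs`),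
  whence the shape `(15, 0)` (`stewartTijdeman1986_of_stewartYu`) — so it is DERIVED inside
  `pasten2024_thm_1_4_1_of_approximationBound`, not assumed (review of the fact decomposition,
  D-0026: the named fact `stewartTijdeman1986_upperBound` is implied by
  `evertseGyory_thm_4_2_1_rat`, `stewartTijdeman1986_of_evertseGyory`, and is no proof
  obligation of this theorem).

This file PROVES the deduction: `pasten2024_thm_1_4_1_of_facts :
evertseGyory_thm_4_2_1_rat → pasten2024_thm_2_5 → pasten2024_thm_1_4_1` (and `…_of_facts'`,
the printed three-input form, with the barrier declaration `BakerMethodBounds` = Stewart–Yu 2001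
supplying the exponential bound), so that the trust base of
`pasten2024_thm_1_4_1` is exactly the two cited theorems 2.1 (i) and 2.5 — the same two named
facts as in `BakerMethodBoundsSubexpProofs.lean` (`pasten2024_thm_1_4_1_of`). The discharge
`pasten2024_thm_1_4_1_holds` is therefore out of reach only through them (Baker's theory and the
modularity/Shimura-curve machinery are not in Mathlib).

## The argument (§4 of the source) and its rendering

With `ξ = b/c`, `1 − ξ = a/c`, so `a ≤ c^{1−η}` gives `η log c ≤ −log |1 − ξ|`
(`eta_mul_log_le`). Put `s = s(R) = √((log R) log₂ R)`, `B = exp s` (`Pasten.sfun`,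
`Pasten.bfun`), `N = ⌊B⌋`, and split `b/c = ξ₀ · ∏_{p ∈ I} p^{e_p}` with `I` the primes of `bc`
with `|e_p| > N` (`Pasten.bigPrimes`, `Pasten.cofactor`, file `PastenSubexpDecomposition`).
Theorem 2.1 (i) on the generators `ξ₀, p (p ∈ I)` gives
`−log |1 − b/c| ≤ Θ · log max{e, h(b/c)}`, `Θ = K^{#I+1} max(1, h(ξ₀)) ∏_{p ∈ I} log p`
(`Pasten.neg_log_abs_one_sub_div_le`, file `PastenSubexpGenerators`; the case `ξ₀ = 1`, where
the source's generating set would contain a torsion element, is treated separately there).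
Then `h(ξ₀) ≤ B log R` and `∏_{p ∈ I} log p ≤ (log R)^{#I}` give `Θ ≤ K B (log R) (K log R)^{#I}`
(`theta_le`); Theorem 2.5 with `ε = 1/3` gives `B^{#I} ≤ (N+1)^{#I} ≤ ∏_{p ∣ abc} ν_p(abc) ≤ k₁ R³`,
so `#I · s ≤ 4 log R` for `log R ≥ log k₁` (`card_bigPrimes_mul_sfun_le`), whence
`(K log R)^{#I} ≤ exp((4 log K + 4) s)` (`mul_log_pow_le_exp`); the exponential bound gives
`log max{e, h(b/c)} ≤ (16 + log 2k₂) log R` (`log_max_height_le`); and `log R ≤ B`,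
`K (16 + log 2k₂) ≤ B` for `log R` large turn the product into `exp((4 log K + 8) s)`.

DEVIATION from the printed proof (immaterial for the statement, whose `κ` is an unspecified
absolute constant): the source bounds `∏_{p ∈ I} log p` by AM–GM and optimises with its
Lemma 3.1 (`t ↦ t log(A/t)` increasing), getting `(K log R/(m−1))^{m−1} ≤ B^{K''}`; here the
cruder `∏_{p ∈ I} log p ≤ (log R)^{#I}` is used, which costs only a factor `2` in `κ`. The
standing convention "the argument of an iterated logarithm is large enough" is the explicit
threshold `R ≥ R₀ = exp(max(e, log k₁, (log(K(16 + log 2k₂)))²))` of the named fact.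

## References

* [Pasten2024] H. Pasten, Invent. Math. 236 (2024), 373–385, doi:10.1007/s00222-024-01244-6,
  arXiv:2312.03566 — Theorem 1.4 (1) (§1), Theorems 2.1 and 2.5 (§2), §4 (proof of Theorem 1.4 (1)).
* [EvertseGyory2015] J.-H. Evertse, K. Győry, *Unit Equations in Diophantine Number Theory*,
  CUP 2015 — Theorem 4.2.1 (p. 68).
* [PastenShimura2024] H. Pasten, *Shimura curves and the abc conjecture*, J. Number Theory 254
  (2024), 214–335 — Theorem 16.8.
-/

noncomputable section

open Finset Real Height
open Literature.NumberTheory.DiophantineGeometry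
open Literature.NumberTheory.DiophantineGeometry.Pasten
open Literature.NumberTheory.DiophantineGeometry.Dioph

namespace Literature.Barriers.ABC

/-! ### Analysis of `s(R) = √((log R) log₂ R)` for `log R ≥ e` -/

section Analysis

variable {R : ℝ}

/-- For `log R ≥ e`: `log₂ R ≥ 1`. [folklore] -/
theorem one_le_loglog (hL : Real.exp 1 ≤ Real.log R) : 1 ≤ Real.log (Real.log R) := by
  rw [← Real.log_exp 1]
  exact Real.log_le_log (Real.exp_pos 1) hL

/-- For `log R ≥ e`: `log R ≥ 1`. [folklore] -/
theorem one_le_log_of_exp_le (hL : Real.exp 1 ≤ Real.log R) : 1 ≤ Real.log R :=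
  le_trans (Real.one_le_exp zero_le_one) hL

/-- `s(R)² = (log R) · log₂ R` for `log R ≥ e`. [folklore] -/
theorem sfun_sq (hL : Real.exp 1 ≤ Real.log R) :
    sfun R ^ 2 = Real.log R * Real.log (Real.log R) := by
  rw [sfun_def, Real.sq_sqrt]
  exact mul_nonneg (le_trans zero_le_one (one_le_log_of_exp_le hL))
    (le_trans zero_le_one (one_le_loglog hL))

/-- `√(log R) ≤ s(R)` for `log R ≥ e`. [folklore] -/
theorem sqrt_log_le_sfun (hL : Real.exp 1 ≤ Real.log R) : Real.sqrt (Real.log R) ≤ sfun R := by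
  rw [sfun_def]
  apply Real.sqrt_le_sqrt
  have h1 := one_le_loglog hL
  have h0 : 0 ≤ Real.log R := le_trans zero_le_one (one_le_log_of_exp_le hL)
  nlinarith

/-- `1 ≤ s(R)` for `log R ≥ e`. [folklore] -/
theorem one_le_sfun (hL : Real.exp 1 ≤ Real.log R) : 1 ≤ sfun R := by
  refine le_trans ?_ (sqrt_log_le_sfun hL)
  rw [show (1 : ℝ) = Real.sqrt 1 from Real.sqrt_one.symm]
  exact Real.sqrt_le_sqrt (one_le_log_of_exp_le hL)

/-- `0 < s(R)` for `log R ≥ e`. [folklore] -/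
theorem sfun_pos (hL : Real.exp 1 ≤ Real.log R) : 0 < sfun R :=
  lt_of_lt_of_le one_pos (one_le_sfun hL)

/-- `log₂ R ≤ s(R)` (as `log₂ R ≤ log R`). [folklore] -/
theorem loglog_le_sfun (hL : Real.exp 1 ≤ Real.log R) : Real.log (Real.log R) ≤ sfun R := by
  have h0 : 0 ≤ Real.log R := le_trans zero_le_one (one_le_log_of_exp_le hL)
  have hℓ0 : 0 ≤ Real.log (Real.log R) := le_trans zero_le_one (one_le_loglog hL)
  rw [sfun_def]
  apply Real.le_sqrt_of_sq_le
  have hle : Real.log (Real.log R) ≤ Real.log R := Real.log_le_self h0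
  nlinarith

/-- `log R ≤ B(R) = exp s(R)` for `log R ≥ e`. [folklore] -/
theorem log_le_exp_sfun (hL : Real.exp 1 ≤ Real.log R) : Real.log R ≤ Real.exp (sfun R) := by
  have hLpos : 0 < Real.log R := lt_of_lt_of_le one_pos (one_le_log_of_exp_le hL)
  calc Real.log R = Real.exp (Real.log (Real.log R)) := (Real.exp_log hLpos).symm
    _ ≤ Real.exp (sfun R) := Real.exp_le_exp.mpr (loglog_le_sfun hL)

/-- The count-to-size conversion (replacing AM–GM and Lemma 3.1 of the source by the crude bound
`∏_{p ∈ I} log p ≤ (log R)^{#I}`): if `n · s(R) ≤ 4 log R`, `K ≥ 1` and `log R ≥ e`, then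
`(K log R)^n ≤ exp((4 log K + 4) · s(R))`. [folklore] -/
theorem mul_log_pow_le_exp {K : ℝ} (hK1 : 1 ≤ K) (hL : Real.exp 1 ≤ Real.log R) {n : ℕ}
    (hn : (n : ℝ) * sfun R ≤ 4 * Real.log R) :
    (K * Real.log R) ^ n ≤ Real.exp ((4 * Real.log K + 4) * sfun R) := by
  have hL1 := one_le_log_of_exp_le hL
  have hLpos : 0 < Real.log R := lt_of_lt_of_le one_pos hL1
  have hℓ1 := one_le_loglog hL
  have hs := sfun_pos hL
  have hsq := sfun_sq hL
  have hK0 : 0 < K := lt_of_lt_of_le one_pos hK1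
  have hlogK : 0 ≤ Real.log K := Real.log_nonneg hK1
  have hKL : 0 < K * Real.log R := mul_pos hK0 hLpos
  rw [← Real.exp_log (pow_pos hKL n), Real.exp_le_exp, Real.log_pow, Real.log_mul hK0.ne' hLpos.ne']
  -- want: n (log K + ℓ) ≤ (4 log K + 4) s; multiply by s > 0
  refine le_of_mul_le_mul_right ?_ hs
  have hn0 : (0 : ℝ) ≤ n := Nat.cast_nonneg n
  calc (n : ℝ) * (Real.log K + Real.log (Real.log R)) * sfun R
      = ((n : ℝ) * sfun R) * (Real.log K + Real.log (Real.log R)) := by ring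
    _ ≤ (4 * Real.log R) * (Real.log K + Real.log (Real.log R)) :=
        mul_le_mul_of_nonneg_right hn (by linarith)
    _ = 4 * (Real.log R * Real.log K) + 4 * (Real.log R * Real.log (Real.log R)) := by ring
    _ ≤ 4 * (Real.log R * Real.log (Real.log R) * Real.log K) +
          4 * (Real.log R * Real.log (Real.log R)) := by
        have : Real.log R * Real.log K ≤ Real.log R * Real.log (Real.log R) * Real.log K := by
          have h := mul_le_mul_of_nonneg_left hℓ1 hLpos.le
          rw [mul_one] at h
          exact mul_le_mul_of_nonneg_right h hlogK
        linarith
    _ = (4 * Real.log K + 4) * sfun R * sfun R := by rw [mul_assoc _ (sfun R), ← sq, hsq]; ring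

/-- From `exp(s)^n ≤ k₁ · R³` with `log k₁ ≤ log R`: `n · s ≤ 4 log R`. [folklore] -/
theorem card_mul_sfun_le {k₁ : ℝ} (hk₁ : 0 < k₁) (hR : 0 < R) (hk₁L : Real.log k₁ ≤ Real.log R)
    {n : ℕ} (h : Real.exp (sfun R) ^ n ≤ k₁ * R ^ 3) : (n : ℝ) * sfun R ≤ 4 * Real.log R := by
  have hpos : 0 < k₁ * R ^ 3 := by positivity
  rw [← Real.exp_nat_mul] at h
  have h2 : (n : ℝ) * sfun R ≤ Real.log (k₁ * R ^ 3) := (Real.le_log_iff_exp_le hpos).mpr h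
  rw [Real.log_mul hk₁.ne' (pow_pos hR 3).ne', Real.log_pow] at h2
  push_cast at h2
  linarith

/-- Absorbing a constant: if `(log C)² ≤ log R` (and `log R ≥ e`, `C > 0`) then `C ≤ exp s(R)`.
[folklore] -/
theorem const_le_exp_sfun {C : ℝ} (hC : 0 < C) (hL : Real.exp 1 ≤ Real.log R)
    (hCL : Real.log C ^ 2 ≤ Real.log R) : C ≤ Real.exp (sfun R) := by
  rw [← Real.exp_log hC, Real.exp_le_exp]
  calc Real.log C ≤ |Real.log C| := le_abs_self _
    _ = Real.sqrt (Real.log C ^ 2) := (Real.sqrt_sq_eq_abs _).symm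
    _ ≤ Real.sqrt (Real.log R) := Real.sqrt_le_sqrt hCL
    _ ≤ sfun R := sqrt_log_le_sfun hL

end Analysis


/-! ### The abc triple: elementary facts -/

section Triple

variable {a b c : ℕ}

/-- The members of an abc triple are non-zero. [folklore] -/
theorem abc_ne_zero (ht : IsABCTriple a b c) : a ≠ 0 ∧ b ≠ 0 ∧ c ≠ 0 := by
  obtain ⟨ha, hb, habc, -⟩ := ht
  exact ⟨ha.ne', hb.ne', by omega⟩

/-- For an abc triple: `gcd(b, c) = 1`, `gcd(bc, a) = 1` and `bc > 1`. [folklore] -/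
theorem abc_coprime_aux (ht : IsABCTriple a b c) :
    b.Coprime c ∧ (b * c).Coprime a ∧ 1 < b * c := by
  obtain ⟨ha, hb, rfl, hcop⟩ := ht
  refine ⟨Nat.coprime_add_self_right.mpr hcop.symm,
    Nat.Coprime.mul_left hcop.symm (Nat.coprime_self_add_left.mpr hcop.symm), ?_⟩
  nlinarith

/-- `rad(bca) = rad(abc)` (reordering for the lemmas of file I, which see `u = b`, `v = c`,
`w = a`). [folklore] -/
theorem radical_bca (a b c : ℕ) :
    UniqueFactorizationMonoid.radical (b * c * a) = rad a b c := by
  rw [rad_def, show b * c * a = a * b * c by ring]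

/-- `exponentProduct(bca) = exponentProduct(abc)`. [folklore] -/
theorem exponentProduct_bca (a b c : ℕ) :
    exponentProduct (b * c * a) = exponentProduct (a * b * c) := by
  rw [show b * c * a = a * b * c by ring]

/-- Step 1 of §4: `1 − b/c = a/c` and `a ≤ c^{1−η}` give `η · log c ≤ −log |1 − b/c|`.
[cite: Pasten2024, §4] -/
theorem eta_mul_log_le (ht : IsABCTriple a b c) {η : ℝ} (haη : (a : ℝ) ≤ (c : ℝ) ^ (1 - η)) :
    η * Real.log c ≤ -Real.log |1 - (b : ℝ) / c| := by
  obtain ⟨ha, hb, habc, -⟩ := ht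
  have ha' : (0 : ℝ) < a := by exact_mod_cast ha
  have hc' : (0 : ℝ) < c := by exact_mod_cast (show 0 < c by omega)
  have hc0 : (c : ℝ) ≠ 0 := hc'.ne'
  have hsum : (a : ℝ) + b = c := by exact_mod_cast habc
  have h1 : 1 - (b : ℝ) / c = a / c := by
    field_simp
    linarith
  rw [h1, abs_of_pos (div_pos ha' hc'), Real.log_div ha'.ne' hc0]
  have h2 : Real.log a ≤ (1 - η) * Real.log c := by
    rw [← Real.log_rpow hc']
    exact Real.log_le_log ha' haη
  rw [sub_mul, one_mul] at h2
  linarith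

/-- Step 5 of §4 (via the exponential abc bound): if `log c ≤ k · R^{15}` with `k ≥ 1` and
`log R ≥ 1`, then `log max{e, h(b/c)} ≤ (16 + log 2k) · log R`. [cite: Pasten2024, §4] -/
theorem log_max_height_le (ht : IsABCTriple a b c) {k : ℝ} (hk : 1 ≤ k)
    (hlogc : Real.log c ≤ k * (rad a b c : ℝ) ^ (15 : ℝ))
    (hL1 : 1 ≤ Real.log (rad a b c : ℝ)) :
    Real.log (max (Real.exp 1) (logHeight₁ ((b : ℚ) / c))) ≤
      (16 + Real.log (2 * k)) * Real.log (rad a b c : ℝ) := by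
  obtain ⟨ha, hb, habc, -⟩ := ht
  have hc : 0 < c := by omega
  haveI : NeZero b := ⟨hb.ne'⟩
  haveI : NeZero c := ⟨hc.ne'⟩
  set R : ℝ := (rad a b c : ℝ) with hRdef
  have hR1 : 1 ≤ R := one_le_rad_real a b c
  have hR : 0 < R := lt_of_lt_of_le one_pos hR1
  have hR15 : 1 ≤ R ^ (15 : ℝ) := Real.one_le_rpow hR1 (by norm_num)
  have he : (1 : ℝ) ≤ Real.exp 1 := Real.one_le_exp zero_le_one
  have hh : logHeight₁ ((b : ℚ) / c) ≤ 2 * k * R ^ (15 : ℝ) := by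
    have h1 : logHeight₁ ((b : ℚ) / c) ≤ Real.log b + Real.log c := by
      rw [div_eq_mul_inv]
      calc logHeight₁ ((b : ℚ) * (c : ℚ)⁻¹)
          ≤ logHeight₁ (b : ℚ) + logHeight₁ ((c : ℚ)⁻¹) := logHeight₁_mul_le _ _
        _ = Real.log b + Real.log c := by
            rw [logHeight₁_inv, Rat.logHeight₁_natCast, Rat.logHeight₁_natCast]
    have h2 : Real.log b ≤ Real.log c :=
      Real.log_le_log (by exact_mod_cast hb) (by exact_mod_cast (show b ≤ c by omega))
    have h3 : k * R ^ (15 : ℝ) ≥ 0 := by positivity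
    linarith
  have hM : max (Real.exp 1) (logHeight₁ ((b : ℚ) / c)) ≤ Real.exp 1 * (2 * k) * R ^ (15 : ℝ) := by
    refine max_le ?_ (hh.trans ?_)
    · have h1 : (1 : ℝ) ≤ 2 * k * R ^ (15 : ℝ) := by nlinarith
      have h2 : (0 : ℝ) < Real.exp 1 := Real.exp_pos 1
      nlinarith
    · have h1 : (0 : ℝ) ≤ 2 * k * R ^ (15 : ℝ) := by positivity
      nlinarith
  have hpos : 0 < max (Real.exp 1) (logHeight₁ ((b : ℚ) / c)) :=
    lt_max_of_lt_left (Real.exp_pos 1)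
  calc Real.log (max (Real.exp 1) (logHeight₁ ((b : ℚ) / c)))
      ≤ Real.log (Real.exp 1 * (2 * k) * R ^ (15 : ℝ)) := Real.log_le_log hpos hM
    _ = 1 + Real.log (2 * k) + 15 * Real.log R := by
        rw [Real.log_mul (by positivity) (by positivity),
          Real.log_mul (by positivity) (by positivity), Real.log_exp, Real.log_rpow hR]
    _ ≤ (16 + Real.log (2 * k)) * Real.log R := by
        have hlk : 0 ≤ Real.log (2 * k) := Real.log_nonneg (by linarith)
        nlinarith

/-- Step 3 of §4: with `N = ⌊B⌋`, `B = exp s(R)`, the quantity `Θ` of the splitting of `b/c`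
satisfies `Θ ≤ K · B · log R · (K log R)^{#I}` (`h(ξ₀) ≤ B log R`, `∏_{p ∈ I} log p ≤ (log R)^{#I}`).
[cite: Pasten2024, §4] -/
theorem theta_le (ht : IsABCTriple a b c) {K : ℝ} (hK1 : 1 ≤ K)
    (hL : Real.exp 1 ≤ Real.log (rad a b c : ℝ)) :
    theta K b c ⌊Real.exp (sfun (rad a b c : ℝ))⌋₊ ≤
      K * Real.exp (sfun (rad a b c : ℝ)) * Real.log (rad a b c : ℝ) *
        (K * Real.log (rad a b c : ℝ)) ^ (bigPrimes b c ⌊Real.exp (sfun (rad a b c : ℝ))⌋₊).card := by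
  obtain ⟨ha0, hb0, hc0⟩ := abc_ne_zero ht
  set R : ℝ := (rad a b c : ℝ) with hRdef
  set s := sfun R with hsdef
  set N := ⌊Real.exp s⌋₊ with hNdef
  set I := bigPrimes b c N with hIdef
  have hL1 := one_le_log_of_exp_le hL
  have hK0 : 0 ≤ K := le_trans zero_le_one hK1
  have hrad : (UniqueFactorizationMonoid.radical (b * c * a) : ℕ) = rad a b c := radical_bca a b c
  have hξ₀ : logHeight₁ (cofactor b c N) ≤ Real.exp s * Real.log R := by
    have h1 := logHeight₁_cofactor_le b c N
    have hprodpos : 0 < ∏ p ∈ (b * c).primeFactors, (p : ℝ) :=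
      Finset.prod_pos fun p hp => by exact_mod_cast (Nat.prime_of_mem_primeFactors hp).pos
    have h2 : Real.log (∏ p ∈ (b * c).primeFactors, (p : ℝ)) ≤ Real.log R := by
      apply Real.log_le_log hprodpos
      have h3 := prod_primeFactors_le_radical hb0 hc0 ha0
      rw [hrad] at h3
      exact h3
    have hN : (N : ℝ) ≤ Real.exp s := Nat.floor_le (Real.exp_pos s).le
    calc logHeight₁ (cofactor b c N)
        ≤ N * Real.log (∏ p ∈ (b * c).primeFactors, (p : ℝ)) := h1
      _ ≤ N * Real.log R := mul_le_mul_of_nonneg_left h2 (Nat.cast_nonneg N)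
      _ ≤ Real.exp s * Real.log R := mul_le_mul_of_nonneg_right hN (by linarith)
  have hmax : max 1 (logHeight₁ (cofactor b c N)) ≤ Real.exp s * Real.log R := by
    refine max_le ?_ hξ₀
    have h1 : (1 : ℝ) ≤ Real.exp s := Real.one_le_exp (sfun_pos hL).le
    nlinarith
  have hprod : ∏ p ∈ I, Real.log p ≤ Real.log R ^ I.card := by
    have h1 := prod_log_bigPrimes_le hb0 hc0 ha0 N
    rw [hrad] at h1
    exact h1
  rw [theta_def]
  calc K ^ (I.card + 1) * (max 1 (logHeight₁ (cofactor b c N)) * ∏ p ∈ I, Real.log p)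
      ≤ K ^ (I.card + 1) * ((Real.exp s * Real.log R) * Real.log R ^ I.card) := by
        apply mul_le_mul_of_nonneg_left _ (pow_nonneg hK0 _)
        exact mul_le_mul hmax hprod (prod_log_bigPrimes_nonneg b c N) (by positivity)
    _ = K * Real.exp s * Real.log R * (K * Real.log R) ^ I.card := by
        rw [pow_succ, mul_pow]; ring

/-- Step 4 of §4 (the Shimura-curve input): `B^{#I} ≤ (N+1)^{#I} ≤ ∏_{p ∣ abc} ν_p(abc) ≤ k₁ R³`
gives `#I · s(R) ≤ 4 log R` once `log R ≥ log k₁`. [cite: Pasten2024, §4] -/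
theorem card_bigPrimes_mul_sfun_le (ht : IsABCTriple a b c) {k₁ : ℝ} (hk₁ : 1 ≤ k₁)
    (hE : (exponentProduct (a * b * c) : ℝ) ≤ k₁ * (rad a b c : ℝ) ^ 3)
    (hk₁L : Real.log k₁ ≤ Real.log (rad a b c : ℝ)) :
    ((bigPrimes b c ⌊Real.exp (sfun (rad a b c : ℝ))⌋₊).card : ℝ) * sfun (rad a b c : ℝ) ≤
      4 * Real.log (rad a b c : ℝ) := by
  obtain ⟨ha0, hb0, hc0⟩ := abc_ne_zero ht
  obtain ⟨hbc, hbca, -⟩ := abc_coprime_aux ht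
  set R : ℝ := (rad a b c : ℝ) with hRdef
  set s := sfun R with hsdef
  set N := ⌊Real.exp s⌋₊ with hNdef
  have hR : 0 < R := lt_of_lt_of_le one_pos (one_le_rad_real a b c)
  apply card_mul_sfun_le (lt_of_lt_of_le one_pos hk₁) hR hk₁L
  have h1 : (N + 1) ^ (bigPrimes b c N).card ≤ exponentProduct (b * c * a) :=
    pow_card_bigPrimes_le_exponentProduct hb0 hc0 hbc ha0 hbca N
  rw [exponentProduct_bca] at h1
  have h2 : Real.exp s ≤ (N : ℝ) + 1 := (Nat.lt_floor_add_one _).le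
  calc Real.exp s ^ (bigPrimes b c N).card
      ≤ ((N : ℝ) + 1) ^ (bigPrimes b c N).card := pow_le_pow_left₀ (Real.exp_pos s).le h2 _
    _ = (((N + 1) ^ (bigPrimes b c N).card : ℕ) : ℝ) := by push_cast; ring
    _ ≤ (exponentProduct (a * b * c) : ℝ) := by exact_mod_cast h1
    _ ≤ k₁ * R ^ 3 := hE

end Triple

/-! ### Assembly: Theorem 1.4 (1) -/

/-- **Pasten's Theorem 1.4 (1), from the approximation bound, Theorem 2.5 and an exponential abc
bound.** For `K ≥ 1` with `PastenApproximationBound K` (Theorem 2.1 (i), `d = 1`),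
`pasten2024_thm_2_5` and an exponential bound `hexp : log c ≤ κ₂ R^{15}` (the shape of
Stewart–Tijdeman 1986, `stewartTijdeman1986_upperBound = BakerShapeBound 15 0`), the statement
`pasten2024_thm_1_4_1` holds, with `κ = 4 log K + 8` and the threshold
`log R ≥ max(e, log k₁, (log (K (16 + log 2k₂)))²)` (`k₁, k₂` the constants of the two bounds,
taken `≥ 1`). This is the printed architecture of §4 with its three inputs explicit; the third
is discharged from the first in `pasten2024_thm_1_4_1_of_approximationBound`.
[cite: Pasten2024, Theorem 1.4 (1) and §4] -/
theorem pasten2024_thm_1_4_1_of_approximationBound_of_exp {K : ℝ}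
    (hK : PastenApproximationBound K) (hK1 : 1 ≤ K) (h25 : pasten2024_thm_2_5)
    (hexp : BakerShapeBound 15 0) : pasten2024_thm_1_4_1 := by
  obtain ⟨κ₁, hκ₁⟩ := h25 (1 / 3) (by norm_num)
  obtain ⟨κ₂, hκ₂⟩ := hexp
  set k₁ : ℝ := max κ₁ 1 with hk₁def
  set k₂ : ℝ := max κ₂ 1 with hk₂def
  set C₃ : ℝ := 16 + Real.log (2 * k₂) with hC₃def
  set L₀ : ℝ := max (Real.exp 1) (max (Real.log k₁) (Real.log (K * C₃) ^ 2)) with hL₀def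
  have hk₁ : 1 ≤ k₁ := le_max_right _ _
  have hk₂ : 1 ≤ k₂ := le_max_right _ _
  have hK0 : 0 < K := lt_of_lt_of_le one_pos hK1
  have hlogK : 0 ≤ Real.log K := Real.log_nonneg hK1
  have hC₃pos : 0 < C₃ := by
    have : 0 ≤ Real.log (2 * k₂) := Real.log_nonneg (by linarith)
    linarith
  refine ⟨4 * Real.log K + 8, by linarith, Real.exp L₀, ?_⟩
  intro a b c ht hR₀ η hη haη
  show Real.log c ≤ η⁻¹ * Real.exp ((4 * Real.log K + 8) * sfun (rad a b c : ℝ))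
  set R : ℝ := (rad a b c : ℝ) with hRdef
  have hR1 : 1 ≤ R := one_le_rad_real a b c
  have hR : 0 < R := lt_of_lt_of_le one_pos hR1
  have hL₀L : L₀ ≤ Real.log R := (Real.le_log_iff_exp_le hR).mpr hR₀
  have hL : Real.exp 1 ≤ Real.log R := le_trans (le_max_left _ _) hL₀L
  have hk₁L : Real.log k₁ ≤ Real.log R :=
    le_trans (le_trans (le_max_left _ _) (le_max_right _ _)) hL₀L
  have hCL : Real.log (K * C₃) ^ 2 ≤ Real.log R :=
    le_trans (le_trans (le_max_right _ _) (le_max_right _ _)) hL₀L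
  have hL1 := one_le_log_of_exp_le hL
  have hL0 : 0 ≤ Real.log R := le_trans zero_le_one hL1
  set s := sfun R with hsdef
  have hs := sfun_pos hL
  set N := ⌊Real.exp s⌋₊ with hNdef
  set n := (bigPrimes b c N).card with hndef
  obtain ⟨ha0, hb0, hc0⟩ := abc_ne_zero ht
  obtain ⟨hbc, -, h1bc⟩ := abc_coprime_aux ht
  -- Step 1: `η log c ≤ −log |1 − b/c|`
  have step1 : η * Real.log c ≤ -Real.log |1 - (b : ℝ) / c| := eta_mul_log_le ht haη
  -- Step 2: the approximation theorem on the splitting of `b/c`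
  have step2 : -Real.log |1 - (b : ℝ) / c| ≤
      theta K b c N * Real.log (max (Real.exp 1) (logHeight₁ ((b : ℚ) / c))) :=
    neg_log_abs_one_sub_div_le hK hK1 hb0 hc0 hbc h1bc N
  -- Step 3: `Θ ≤ K B (log R) (K log R)^n`
  have step3 : theta K b c N ≤ K * Real.exp s * Real.log R * (K * Real.log R) ^ n :=
    theta_le ht hK1 hL
  -- Step 4: `n s ≤ 4 log R`, hence `(K log R)^n ≤ exp((4 log K + 4) s)`
  have hE : (exponentProduct (a * b * c) : ℝ) ≤ k₁ * R ^ 3 := by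
    have h := hκ₁ a b c ht
    have h3 : R ^ (8 / 3 + 1 / 3 : ℝ) = R ^ 3 := by
      rw [show (8 / 3 + 1 / 3 : ℝ) = ((3 : ℕ) : ℝ) by norm_num, Real.rpow_natCast]
    rw [h3] at h
    exact h.trans (mul_le_mul_of_nonneg_right (le_max_left _ _) (by positivity))
  have step4a : (n : ℝ) * s ≤ 4 * Real.log R := card_bigPrimes_mul_sfun_le ht hk₁ hE hk₁L
  have step4 : (K * Real.log R) ^ n ≤ Real.exp ((4 * Real.log K + 4) * s) :=
    mul_log_pow_le_exp hK1 hL step4a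
  -- Step 5: `log max{e, h(b/c)} ≤ C₃ log R`
  have hlogc : Real.log c ≤ k₂ * R ^ (15 : ℝ) := by
    have h := hκ₂ a b c ht
    rw [pow_zero, mul_one] at h
    exact h.trans (mul_le_mul_of_nonneg_right (le_max_left _ _) (by positivity))
  have step5 : Real.log (max (Real.exp 1) (logHeight₁ ((b : ℚ) / c))) ≤ C₃ * Real.log R :=
    log_max_height_le ht hk₂ hlogc hL1
  -- Step 6: combine, absorbing `log R ≤ B` and `K C₃ ≤ B`
  have hLB : Real.log R ≤ Real.exp s := log_le_exp_sfun hL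
  have hKC : K * C₃ ≤ Real.exp s := const_le_exp_sfun (by positivity) hL hCL
  have hlm0 : 0 ≤ Real.log (max (Real.exp 1) (logHeight₁ ((b : ℚ) / c))) :=
    le_trans zero_le_one (one_le_log_max_exp_one _)
  have main : η * Real.log c ≤ Real.exp ((4 * Real.log K + 8) * s) :=
    calc η * Real.log c
        ≤ theta K b c N * Real.log (max (Real.exp 1) (logHeight₁ ((b : ℚ) / c))) :=
          step1.trans step2
      _ ≤ (K * Real.exp s * Real.log R * (K * Real.log R) ^ n) * (C₃ * Real.log R) :=
          mul_le_mul step3 step5 hlm0 (by positivity)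
      _ ≤ (K * Real.exp s * Real.exp s * Real.exp ((4 * Real.log K + 4) * s)) *
            (C₃ * Real.exp s) := by
          apply mul_le_mul _ _ (by positivity) (by positivity)
          · apply mul_le_mul _ step4 (by positivity) (by positivity)
            exact mul_le_mul_of_nonneg_left hLB (by positivity)
          · exact mul_le_mul_of_nonneg_left hLB hC₃pos.le
      _ = (K * C₃) *
            (Real.exp s * Real.exp s * Real.exp s * Real.exp ((4 * Real.log K + 4) * s)) := by
          ring
      _ ≤ Real.exp s *
            (Real.exp s * Real.exp s * Real.exp s * Real.exp ((4 * Real.log K + 4) * s)) :=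
          mul_le_mul_of_nonneg_right hKC (by positivity)
      _ = Real.exp (s + s + s + s + (4 * Real.log K + 4) * s) := by
          simp only [Real.exp_add]; ring
      _ = Real.exp ((4 * Real.log K + 8) * s) := by
          congr 1; ring
  calc Real.log c = η⁻¹ * (η * Real.log c) := by field_simp
    _ ≤ η⁻¹ * Real.exp ((4 * Real.log K + 8) * s) :=
        mul_le_mul_of_nonneg_left main (inv_pos.mpr hη).le

/-- **Pasten's Theorem 1.4 (1), from the approximation bound and Theorem 2.5 alone.** For
`K ≥ 1` with `PastenApproximationBound K` and `pasten2024_thm_2_5`, the statement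
`pasten2024_thm_1_4_1` holds: the exponential bound required by
`pasten2024_thm_1_4_1_of_approximationBound_of_exp` ("any exponential bound for the `ABC`
conjecture (such as the one in [ABC1] which gives `K' = 15`)") is itself a consequence of the
approximation bound — Stewart–Yu's `log c ≤ κ R^{1/3} (log R)³`
(`bakerShapeBound_third_three_of_approximationBound`), hence `log c ≤ κ' R^{15}`
(`stewartTijdeman1986_of_stewartYu`). [cite: Pasten2024, Theorem 1.4 (1) and §4] -/
theorem pasten2024_thm_1_4_1_of_approximationBound {K : ℝ} (hK : PastenApproximationBound K)
    (hK1 : 1 ≤ K) (h25 : pasten2024_thm_2_5) : pasten2024_thm_1_4_1 :=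
  pasten2024_thm_1_4_1_of_approximationBound_of_exp hK hK1 h25
    (stewartTijdeman1986_of_stewartYu (bakerShapeBound_third_three_iff.mp
      (bakerShapeBound_third_three_of_approximationBound hK1 hK)))

/-- **Pasten 2024, Theorem 1.4 (1), conditionally on the two named facts it rests on**:
Evertse–Győry's Theorem 4.2.1 over `ℚ` (linear forms in logarithms;
`evertseGyory_thm_4_2_1_rat`, giving Theorem 2.1 via `pasten2024_thm_2_1`) and Pasten's
Shimura-curve bound (Theorem 2.5, `pasten2024_thm_2_5`). The third input of the printed proof,
the exponential abc bound of Stewart–Tijdeman (`stewartTijdeman1986_upperBound`), follows from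
the first (`stewartTijdeman1986_of_evertseGyory`) and is not assumed.
[cite: Pasten2024, Theorem 1.4 (1) and §4] -/
theorem pasten2024_thm_1_4_1_of_facts (h₁ : evertseGyory_thm_4_2_1_rat)
    (h₂ : pasten2024_thm_2_5) : pasten2024_thm_1_4_1 :=
  pasten2024_thm_1_4_1_of_approximationBound (pasten2024_thm_2_1 h₁) one_le_pastenK h₂

/-- The printed three-input form: the same deduction with the barrier declaration
`BakerMethodBounds` (= Stewart–Yu 2001, `stewart_yu`) supplying the exponential input.
[cite: Pasten2024, Theorem 1.4 (1) and §4] -/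
theorem pasten2024_thm_1_4_1_of_facts' (h₁ : evertseGyory_thm_4_2_1_rat)
    (h₂ : pasten2024_thm_2_5) (h₃ : BakerMethodBounds) : pasten2024_thm_1_4_1 :=
  pasten2024_thm_1_4_1_of_approximationBound_of_exp (pasten2024_thm_2_1 h₁) one_le_pastenK h₂
    (stewartTijdeman1986_of_stewartYu (BakerMethodBounds_iff_stewartYu.mp h₃))

end Literature.Barriers.ABC

end
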